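import Literature.Analysis.FluidPDE.TaoCascadeDuhamel
import Literature.Analysis.FluidPDE.ClassicalSolution
import Literature.Analysis.FluidPDE.LerayHopf
import Literature.Analysis.FluidPDE.NSWave0
import HarnessLib

/-!
# Fluid computer blueprint — the CASCADE WITNESS interface and the soft assembly

HONEST FRAMING: low prior, high value-of-information experiment on Tao's machine paradigm; NOT a
claim that NS blows up.

Tao (J. Amer. Math. Soc. 29 (2016), §1.3, pp. 10–11) describes the blow-up mechanism of his averaged
equation as an idealised **machine**: a configuration of energy at frequency scale `λ_n` which, when
run under the dynamics, "abruptly" pushes (almost all of) its energy into a rescaled copy of itself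
at scale `λ_{n+1} = 2λ_n` within a time `T_n` with `∑ T_n < ∞`, and he lists what a TRUE
Navier–Stokes implementation would need (logic gates out of ideal fluid, a self-replicating "von
Neumann" architecture, noise tolerance, and enough abruptness to outrun viscosity). This file types
the *logical structure* of that mechanism as an interface over the tree's formalisation of Tao's
framework (`Tao2016.IsMildSolutionFor`, `eulerForm` = the TRUE Navier–Stokes bilinear form (1.5),
`ν = 1`, `H¹⁰_df`-mild solutions (1.15)), and proves the SOFT part of the assembly:

* `CascadeWitness` — a Schwartz divergence-free datum `u₀`, stage sets `stage n ⊆ L²` (the machine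
  "at generation `n`"), transfer times `T n ≥ 0` with `Summable T`, an `H¹`-concentration floor
  `floor n → ∞` on `stage n`, the ignition `u₀ ∈ stage 0`, and the REALISATION axiom `fires`: every
  `H¹⁰_df`-mild Navier–Stokes trajectory from `u₀` that sits in `stage n` at a time `t` and lives
  past `t + T n` visits `stage (n+1)` during `[t, t + T n]`. (`fires` is where ALL the fluid
  mechanics of a putative machine would go; here it is an axiom of the interface — see the
  blueprint's `ASSEMBLY.md` for which parts are physically plausible and which are idea-bound.)
* `CascadeWitness.lifespan_le` (THEOREM A, unconditional) — every mild trajectory from `u₀` has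
  lifespan `≤ T_* := ∑ T_n`: the visits `t_n ≤ ∑_{m<n} T_m < T_*` carry `‖u(t_n)‖²_{H¹} ≥ floor n → ∞`,
  while an `H¹⁰`-continuous curve is `H¹⁰`-bounded on the compact interval `[0, T_*]`
  (Tao, Lemma 4.1 (4.6): `ContinuousInH10On.exists_bound`).
* `exists_maximal_of_lifespan_le` / `x5a_of_lifespan_le` (THEOREM B, conditional on two named
  standard facts, ALL CLAUSES PROVED in the tree on the summit side — `H10MildTheory` (local
  existence, uniqueness and the `H¹⁰` continuation criterion for `H¹⁰_df`-mild solutions of the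
  true equation) and the mild-maximal ⇒ classical blow-up bookkeeping `MildMaximalGivesBlowup`): a lifespan bound yields a
  maximal mild solution with unbounded `H¹⁰` norm (blow-up of a stated norm) and a finite-energy
  classical solution from a Schwartz datum with finite maximal time of existence (X5a, the negation
  side of Clay (A)); `x5a_of_cascadeWitness` combines A and B.

Nothing here asserts that a `CascadeWitness` exists.

## References

* T. Tao, *Finite time blowup for an averaged three-dimensional Navier–Stokes equation*, J. Amer.
  Math. Soc. 29 (2016) 601–674, arXiv:1402.0290v3: §1.1 (1.5), (1.15); §1.3 pp. 10–11 (the machine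
  programme and its obstructions); Lemma 4.1 (4.6); Thm. 1.5. [Tao2016AveragedNS]
* J. T. Beale, T. Kato, A. Majda, Comm. Math. Phys. 94 (1984), §1 (maximal smooth solutions). [BealeKatoMajda1984]
-/

noncomputable section

open MeasureTheory Set Filter Topology
open scoped ENNReal NNReal SchwartzMap InnerProductSpace

namespace Literature.Analysis.FluidPDE.FluidComputer

open Literature.Analysis.FluidPDE.Tao2016
open Literature.Analysis.FunctionSpaces (eFourierSobolevNorm)

/-! ### Two small facts about Tao's framework -/

/-- `‖f‖_{H¹} ≤ ‖f‖_{H¹⁰}` (the weight `(1+|ξ|²)^s` is monotone in `s` since `1+|ξ|² ≥ 1`; the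
general monotonicity of the Sobolev scale is the summit-side lemma
`PerpetualPumpThesis.B.eFourierSobolevNorm_mono`, whose promotion to `Literature/` is requested —
only this instance is needed here). [folklore] -/
theorem eFourierSobolevNorm_one_le_ten (f : L2C) :
    eFourierSobolevNorm 1 f ≤ eFourierSobolevNorm 10 f := by
  unfold eFourierSobolevNorm
  refine ENNReal.rpow_le_rpow (lintegral_mono fun ξ => ?_) (by norm_num)
  exact mul_le_mul' (ENNReal.ofReal_le_ofReal
    (Real.rpow_le_rpow_of_exponent_le (le_add_of_nonneg_right (sq_nonneg _)) (by norm_num))) le_rfl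

/-- **A mild solution attains an `H¹⁰_df` datum in `L²`**: if the datum `a` itself lies in `H¹⁰_df`
then `u 0 = a` (both are `H¹⁰_df` fields with the same pairings against `H¹⁰_df`, Tao (1.15) at
`t = 0`; test with `w = u 0 - a`, a real field orthogonal to itself). [cite: Tao2016AveragedNS, §1.1 (1.15)] -/
theorem initial_eq {F : L2C → L2C → L2C → ℂ} {a : L2C} {I : Set ℝ} {u : ℝ → L2C}
    (hu : IsMildSolutionFor F a I u) (h0 : (0 : ℝ) ∈ I) (ha : MemH10df a) : u 0 = a := by
  set d : L2C := u 0 - a with hd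
  have hd10 : MemH10df d := (hu.1 0 h0).sub ha
  have h := hu.initial h0 hd10
  rw [pairing_eq_inner hd10.2.1, pairing_eq_inner hd10.2.1] at h
  have hself : ⟪d, d⟫_ℂ = 0 := by
    rw [hd, inner_sub_right, h, sub_self]
  exact sub_eq_zero.1 (inner_self_eq_zero.1 hself)

/-! ### The interface -/

/-- **A cascade witness for the TRUE Navier–Stokes equations** (`ν = 1`, Tao's `H¹⁰_df`-mild
formulation (1.5)/(1.15) of `∂ₜu = Δu + B(u,u)`): the logical skeleton of Tao's blow-up machine
(2016, §1.3) with every piece of fluid mechanics packed into the single axiom `fires`.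

* `u₀` — the ignition datum, a real divergence-free Schwartz field (the data class of Clay (A) and
  of Tao's Thm. 1.5), with `schwartzL2 u₀ ∈ H¹⁰_df` recorded as the field `memH10df` (a theorem of
  the tree for every such `u₀`; kept as a field so that this file stays inside `Literature/`);
* `stage n` — the set of `L²` states "the machine at generation `n`" (energy at frequency `∼ 2ⁿλ₀`);
* `T n ≥ 0`, `Summable T` — the transfer-time allowances (abruptness: `∑ T_n < ∞`);
* `floor n → +∞` with `floor n ≤ ‖v‖²_{H¹}` on `stage n` — concentration at ever finer scales;
* `ignition` — `u₀ ∈ stage 0`;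
* `fires` — REALISATION (idea-bound): along EVERY `H¹⁰_df`-mild Navier–Stokes trajectory `u` from
  `u₀` on `[0,S)`, if `u t ∈ stage n` (`t ≥ 0`) and `t + T n < S`, then `u s ∈ stage (n+1)` for some
  `s ∈ [t, t + T n]`. By uniqueness of mild solutions there is only one trajectory, but the axiom is
  stated for all of them so that no uniqueness theorem is needed to USE it.

No leakage, robustness or architecture parameter appears here: they are the burden of whoever
proves `fires` (the gadget level, `GadgetCascade.lean`). [cite: Tao2016AveragedNS, §1.3 pp. 10–11] -/
structure CascadeWitness where
  /-- the ignition datum -/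
  u₀ : 𝓢(EuclideanSpace ℝ (Fin 3), EuclideanSpace ℝ (Fin 3))
  /-- it is divergence free -/
  divFree : VectorCalculus.IsDivFree ⇑u₀
  /-- its `L²` class lies in `H¹⁰_df` (true for every divergence-free Schwartz field) -/
  memH10df : MemH10df (schwartzL2 u₀)
  /-- the stage sets -/
  stage : ℕ → Set L2C
  /-- the transfer-time allowances -/
  T : ℕ → ℝ
  T_nonneg : ∀ n, 0 ≤ T n
  /-- abruptness: the allowances are summable -/
  summable_T : Summable T
  /-- the `H¹` concentration floors -/
  floor : ℕ → ℝ
  /-- concentration at arbitrarily fine scales -/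
  tendsto_floor : Tendsto floor atTop atTop
  /-- on stage `n` the squared `H¹` norm is at least `floor n` -/
  floor_le : ∀ n, ∀ v ∈ stage n, ENNReal.ofReal (floor n) ≤ eFourierSobolevNorm 1 v ^ 2
  /-- ignition: the datum is a generation-`0` machine state -/
  ignition : schwartzL2 u₀ ∈ stage 0
  /-- REALISATION (idea-bound): the Navier–Stokes flow carries stage `n` into stage `n+1` within
  time `T n`, along every mild trajectory that lives that long -/
  fires : ∀ (S : ℝ) (u : ℝ → L2C), IsMildSolutionFor eulerForm (schwartzL2 u₀) (Ico 0 S) u →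
    ∀ (n : ℕ) (t : ℝ), 0 ≤ t → u t ∈ stage n → t + T n < S →
      ∃ s : ℝ, t ≤ s ∧ s ≤ t + T n ∧ u s ∈ stage (n + 1)

namespace CascadeWitness

variable (W : CascadeWitness)

/-- The blow-up time bound `T_* = ∑ₙ T_n`. [folklore] -/
def Tstar : ℝ := ∑' n, W.T n

/-- Partial sums of the allowances stay below `T_*`. [folklore] -/
theorem sum_T_le_Tstar (n : ℕ) : ∑ m ∈ Finset.range n, W.T m ≤ W.Tstar :=
  W.summable_T.sum_le_tsum _ fun m _ => W.T_nonneg m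

/-- `0 ≤ T_*`. [folklore] -/
theorem Tstar_nonneg : 0 ≤ W.Tstar := by
  simpa using W.sum_T_le_Tstar 0

/-- **The schedule**: a mild trajectory from `u₀` living past `T_*` visits stage `n` at a time
`t_n ∈ [0, ∑_{m<n} T_m]`, for every `n` (induction on `n` with `fires`; the base case is
`u(0) = u₀ ∈ stage 0`). [cite: Tao2016AveragedNS, §1.3 pp. 10–11] -/
theorem exists_visit {S : ℝ} {u : ℝ → L2C}
    (hu : IsMildSolutionFor eulerForm (schwartzL2 W.u₀) (Ico 0 S) u) (hS : W.Tstar < S) (n : ℕ) :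
    ∃ t : ℝ, 0 ≤ t ∧ t ≤ ∑ m ∈ Finset.range n, W.T m ∧ u t ∈ W.stage n := by
  induction n with
  | zero =>
    refine ⟨0, le_rfl, by simp, ?_⟩
    rw [initial_eq hu ⟨le_rfl, W.Tstar_nonneg.trans_lt hS⟩ W.memH10df]
    exact W.ignition
  | succ n ih =>
    obtain ⟨t, ht0, htle, hmem⟩ := ih
    have hsum : t + W.T n ≤ ∑ m ∈ Finset.range (n + 1), W.T m := by
      rw [Finset.sum_range_succ]; linarith
    have htS : t + W.T n < S := (hsum.trans (W.sum_T_le_Tstar (n + 1))).trans_lt hS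
    obtain ⟨s, hts, hst, hs⟩ := W.fires S u hu n t ht0 hmem htS
    exact ⟨s, ht0.trans hts, hst.trans hsum, hs⟩

/-- **THEOREM A (lifespan bound).** Every `H¹⁰_df`-mild Navier–Stokes trajectory from the ignition
datum of a cascade witness has lifespan `S ≤ T_* = ∑ T_n`: otherwise the visits `t_n ≤ T_*` carry
`‖u(t_n)‖²_{H¹} ≥ floor n → ∞`, contradicting the bound `sup_{[0,T_*]} ‖u‖_{H¹⁰} < ∞` of an
`H¹⁰`-continuous curve on a compact interval (Tao, Lemma 4.1 (4.6)). [cite: Tao2016AveragedNS, §1.3 pp. 10–11] -/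
theorem lifespan_le {S : ℝ} {u : ℝ → L2C}
    (hu : IsMildSolutionFor eulerForm (schwartzL2 W.u₀) (Ico 0 S) u) : S ≤ W.Tstar := by
  by_contra hS
  push Not at hS
  have hsub : Icc 0 W.Tstar ⊆ Ico 0 S := fun t ht => ⟨ht.1, ht.2.trans_lt hS⟩
  obtain ⟨M, hM⟩ := ContinuousInH10On.exists_bound (hu.2.1.mono hsub)
    fun t ht => (hu.1 t (hsub ht)).1
  -- every floor is ≤ M²
  have hfloor : ∀ n, W.floor n ≤ M ^ 2 := by
    intro n
    obtain ⟨t, ht0, htle, hmem⟩ := W.exists_visit hu hS n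
    have htI : t ∈ Icc 0 W.Tstar := ⟨ht0, htle.trans (W.sum_T_le_Tstar n)⟩
    have hfin : eFourierSobolevNorm 10 (u t) ≠ ∞ := (hu.1 t (hsub htI)).1.ne
    have hMt := hM t htI
    have hM0 : 0 ≤ M := ENNReal.toReal_nonneg.trans hMt
    have h1 : ENNReal.ofReal (W.floor n) ≤ ENNReal.ofReal (M ^ 2) :=
      calc ENNReal.ofReal (W.floor n) ≤ eFourierSobolevNorm 1 (u t) ^ 2 := W.floor_le n _ hmem
        _ ≤ eFourierSobolevNorm 10 (u t) ^ 2 := by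
            gcongr; exact eFourierSobolevNorm_one_le_ten _
        _ = ENNReal.ofReal ((eFourierSobolevNorm 10 (u t)).toReal) ^ 2 := by
            rw [ENNReal.ofReal_toReal hfin]
        _ ≤ ENNReal.ofReal M ^ 2 := by gcongr
        _ = ENNReal.ofReal (M ^ 2) := by rw [ENNReal.ofReal_pow hM0]
    exact (ENNReal.ofReal_le_ofReal_iff (sq_nonneg M)).1 h1
  -- but the floors tend to `+∞`
  obtain ⟨n, hn⟩ := (W.tendsto_floor.eventually (eventually_gt_atTop (M ^ 2))).exists
  exact absurd (hfloor n) (not_le.2 hn)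

/-- Restatement of Theorem A as a property of the datum: the witness's `u₀` has UNIFORMLY BOUNDED
mild lifespans. [cite: Tao2016AveragedNS, §1.3 pp. 10–11] -/
theorem lifespan_bounded :
    ∃ Tb : ℝ, ∀ (S : ℝ) (u : ℝ → L2C),
      IsMildSolutionFor eulerForm (schwartzL2 W.u₀) (Ico 0 S) u → S ≤ Tb :=
  ⟨W.Tstar, fun _ _ hu => W.lifespan_le hu⟩

end CascadeWitness

/-! ### The standard `H¹⁰_df` theory of the true equation, as named hypotheses

The two named hypotheses below are the inputs of Theorem B. Each clause is a standard fact (Tao 2016, §1.1,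
after (1.15): "the local existence theory is standard") and each is PROVED in the tree on the summit
side (for an arbitrary averaging datum, in particular for the Euler form): they are hypotheses here
only because `Literature/` does not import `Summits/`. -/

/-- **The standard `H¹⁰_df` theory of the true Navier–Stokes equation** (`ν = 1`, Tao's form
(1.5)/(1.15); Tao 2016, §1.1 after (1.15): "the local existence theory is standard"), as ONE named
hypothesis with three clauses, each PROVED in the tree on the summit side for an arbitrary averaging
datum and hence for the Euler form (`PerpetualPumpThesis.stub_thesis_LocalExistenceH10`,
`PerpetualPumpThesis.stub_uniqueness`, `PerpetualPumpThesis.Floor.extends_of_H10_bounded`, with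
`AveragedTypeI.euler_form_eq`):
* `localExistence` — every `H¹⁰_df` datum has a mild solution on some `[0,T)`, `T > 0`;
* `uniqueness` — two mild solutions on `[0,T)` with the same datum coincide;
* `continuation` — a mild solution on `[0,T)`, `T > 0`, with bounded `H¹⁰` norm extends to a
  strictly longer interval. [cite: Tao2016AveragedNS, §1.1 (1.15)] -/
structure H10MildTheory : Prop where
  /-- local existence from `H¹⁰_df` data -/
  localExistence : ∀ a : L2C, MemH10df a →
    ∃ T : ℝ, 0 < T ∧ ∃ u : ℝ → L2C, IsMildSolutionFor eulerForm a (Ico 0 T) u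
  /-- uniqueness on `[0,T)` -/
  uniqueness : ∀ (a : L2C) (T : ℝ) (u v : ℝ → L2C),
    IsMildSolutionFor eulerForm a (Ico 0 T) u → IsMildSolutionFor eulerForm a (Ico 0 T) v →
      ∀ t ∈ Ico 0 T, u t = v t
  /-- the `H¹⁰` continuation criterion -/
  continuation : ∀ (a : L2C) (T : ℝ), 0 < T → ∀ u : ℝ → L2C,
    IsMildSolutionFor eulerForm a (Ico 0 T) u →
      ∀ C : ℝ, (∀ t ∈ Ico 0 T, eFourierSobolevNorm 10 (u t) ≤ ENNReal.ofReal C) →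
        ∃ T' : ℝ, T < T' ∧ ∃ v : ℝ → L2C,
          IsMildSolutionFor eulerForm a (Ico 0 T') v ∧ ∀ t ∈ Ico 0 T, v t = u t

/-- **Mild-maximal ⇒ classical blow-up (X5a)**: an `H¹⁰_df`-mild solution of the true equation from
a Schwartz divergence-free datum on `[0,S)` with no mild extension past `S` yields a maximal smooth
solution with finite lifespan, Leray–Hopf from its rapidly decaying datum. Verbatim the summit-side
statement `PumpContinuation.MildBlowupClassical`, proved in the tree
(`pumpContinuation_mildBlowupClassical_proof`: Kato's `L³` theory, Lemarié-Rieusset Thm. 15.1,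
weak–strong uniqueness). [cite: Tao2016AveragedNS, §1.1 (1.5)] -/
def MildMaximalGivesBlowup : Prop :=
  ∀ u₀ : 𝓢(EuclideanSpace ℝ (Fin 3), EuclideanSpace ℝ (Fin 3)), VectorCalculus.IsDivFree ⇑u₀ →
    ∀ S : ℝ, 0 < S → ∀ u : ℝ → L2C, IsMildSolutionFor eulerForm (schwartzL2 u₀) (Ico 0 S) u →
      (¬ ∃ S' : ℝ, S < S' ∧ ∃ v : ℝ → L2C,
          IsMildSolutionFor eulerForm (schwartzL2 u₀) (Ico 0 S') v ∧ ∀ t ∈ Ico 0 S, v t = u t) →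
        ∃ T : ℝ, 0 < T ∧ ∃ (w : ℝ → EuclideanSpace ℝ (Fin 3) → EuclideanSpace ℝ (Fin 3))
          (p : ℝ → EuclideanSpace ℝ (Fin 3) → ℝ),
          IsMaximalSmoothSolution 1 0 w p T ∧ IsLerayHopfOn T 1 0 (w 0) w ∧ HasRapidSpatialDecay (w 0)

/-! ### Theorem B: a lifespan bound gives a maximal mild solution, norm blow-up, and X5a -/

/-- **A mild solution on a union of nested intervals.** If for every `t < S` some initial segment
`[0, S')`, `t < S' ≤ S`, carries a mild solution equal to `U`, then `U` is a mild solution on `[0,S)`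
(the three clauses of Tao's definition are local in time). [folklore] -/
theorem isMildSolutionFor_of_local {F : L2C → L2C → L2C → ℂ} {a : L2C} {S : ℝ} {U : ℝ → L2C}
    (h : ∀ t, t < S → ∃ S', t < S' ∧ S' ≤ S ∧ IsMildSolutionFor F a (Ico 0 S') U) :
    IsMildSolutionFor F a (Ico 0 S) U := by
  refine ⟨fun t ht => ?_, fun t₀ ht₀ => ?_, fun t ht w hw => ?_⟩
  · obtain ⟨S', htS', -, hU⟩ := h t ht.2
    exact hU.1 t ⟨ht.1, htS'⟩
  · obtain ⟨S', htS', hS'S, hU⟩ := h t₀ ht₀.2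
    have hc := hU.2.1 t₀ ⟨ht₀.1, htS'⟩
    have heq : 𝓝[Ico 0 S] t₀ = 𝓝[Ico 0 S'] t₀ := by
      rw [nhdsWithin_restrict' (Ico 0 S) (Iio_mem_nhds htS')]
      congr 1
      ext s
      exact ⟨fun ⟨hs, hs'⟩ => ⟨hs.1, hs'⟩, fun hs => ⟨⟨hs.1, hs.2.trans_le hS'S⟩, hs.2⟩⟩
    rw [heq]
    exact hc
  · obtain ⟨S', htS', -, hU⟩ := h t ht.2
    exact hU.2.2 t ⟨ht.1, htS'⟩ w hw

/-- **THEOREM B, part 1 (the maximal mild solution).** Under local existence and uniqueness, an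
`H¹⁰_df` datum all of whose mild solutions have lifespan `≤ Tb` carries a mild solution on a maximal
interval `[0, S_m)`, `0 < S_m ≤ Tb`, admitting no mild extension (glue the solutions on all
`[0,S) `, `S < S_m = sup` of the lifespans, by uniqueness). [folklore] -/
theorem exists_maximal_of_lifespan_le (hth : H10MildTheory) {a : L2C} (ha : MemH10df a) {Tb : ℝ}
    (hle : ∀ (S : ℝ) (u : ℝ → L2C), IsMildSolutionFor eulerForm a (Ico 0 S) u → S ≤ Tb) :
    ∃ Sm : ℝ, 0 < Sm ∧ Sm ≤ Tb ∧ ∃ U : ℝ → L2C, IsMildSolutionFor eulerForm a (Ico 0 Sm) U ∧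
      ¬ ∃ S' : ℝ, Sm < S' ∧ ∃ v : ℝ → L2C,
        IsMildSolutionFor eulerForm a (Ico 0 S') v ∧ ∀ t ∈ Ico 0 Sm, v t = U t := by
  classical
  obtain ⟨S₀, hS₀, u₀, hu₀⟩ := hth.localExistence a ha
  set L : Set ℝ := {S | ∃ u : ℝ → L2C, IsMildSolutionFor eulerForm a (Ico 0 S) u} with hL
  have hLne : L.Nonempty := ⟨S₀, u₀, hu₀⟩
  have hLbdd : BddAbove L := ⟨Tb, fun S ⟨u, hu⟩ => hle S u hu⟩
  have hS₀le : S₀ ≤ sSup L := le_csSup hLbdd ⟨u₀, hu₀⟩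
  have hpos : 0 < sSup L := hS₀.trans_le hS₀le
  have hleTb : sSup L ≤ Tb := csSup_le hLne fun S ⟨u, hu⟩ => hle S u hu
  -- below the supremum there is always a solution living a little longer
  have hex : ∀ t, t < sSup L → ∃ S, t < S ∧ S ≤ sSup L ∧ ∃ u : ℝ → L2C,
      IsMildSolutionFor eulerForm a (Ico 0 S) u := by
    intro t ht
    obtain ⟨S, ⟨u, hu⟩, htS⟩ := exists_lt_of_lt_csSup hLne ht
    exact ⟨S, htS, le_csSup hLbdd ⟨u, hu⟩, u, hu⟩
  choose Sof hSof_gt hSof_le uof huof using hex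
  -- the glued curve
  set U : ℝ → L2C := fun t => if h : t < sSup L then uof t h t else 0 with hUdef
  -- it agrees with every solution wherever both live
  have hagree : ∀ (S : ℝ) (v : ℝ → L2C), IsMildSolutionFor eulerForm a (Ico 0 S) v →
      ∀ t ∈ Ico 0 S, t < sSup L → U t = v t := by
    intro S v hv t ht htsup
    have hU : U t = uof t htsup t := by simp only [hUdef, dif_pos htsup]
    rw [hU]
    have h1 : IsMildSolutionFor eulerForm a (Ico 0 (min S (Sof t htsup))) (uof t htsup) :=
      (huof t htsup).mono (Ico_subset_Ico_right (min_le_right _ _))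
    have h2 : IsMildSolutionFor eulerForm a (Ico 0 (min S (Sof t htsup))) v :=
      hv.mono (Ico_subset_Ico_right (min_le_left _ _))
    exact hth.uniqueness a _ _ _ h1 h2 t ⟨ht.1, lt_min ht.2 (hSof_gt t htsup)⟩
  have hUsol : IsMildSolutionFor eulerForm a (Ico 0 (sSup L)) U := by
    refine isMildSolutionFor_of_local fun t ht => ⟨Sof t ht, hSof_gt t ht, hSof_le t ht, ?_⟩
    -- on `[0, Sof t)` the curve `U` coincides with the solution `uof t`
    have hv := huof t ht
    have heqv : ∀ s ∈ Ico 0 (Sof t ht), U s = uof t ht s :=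
      fun s hs => hagree _ _ hv s hs (hs.2.trans_le (hSof_le t ht))
    refine ⟨fun s hs => (heqv s hs).symm ▸ hv.1 s hs, fun s₀ hs₀ => ?_, fun s hs w hw => ?_⟩
    · have hc := hv.2.1 s₀ hs₀
      refine hc.congr' ?_
      filter_upwards [self_mem_nhdsWithin] with s hs
      rw [heqv s hs, heqv s₀ hs₀]
    · rw [heqv s hs, hv.2.2 s hs w hw]
      congr 1
      refine intervalIntegral.integral_congr fun r hr => ?_
      have hr' : r ∈ Icc 0 s := by rwa [uIcc_of_le hs.1] at hr
      have hrI : r ∈ Ico 0 (Sof t ht) := ⟨hr'.1, hr'.2.trans_lt hs.2⟩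
      simp only [heqv r hrI]
  refine ⟨sSup L, hpos, hleTb, U, hUsol, ?_⟩
  rintro ⟨S', hS', v, hv, -⟩
  exact absurd (le_csSup hLbdd ⟨v, hv⟩) (not_le.2 hS')

/-- **THEOREM B, part 2 (blow-up of the `H¹⁰` norm).** With the continuation criterion, the maximal
mild solution of part 1 has unbounded `H¹⁰` norm on `[0, S_m)`: energy has moved to arbitrarily fine
scales by the finite time `S_m ≤ Tb`. [folklore] -/
theorem exists_maximal_unbounded_of_lifespan_le (hth : H10MildTheory) {a : L2C} (ha : MemH10df a) {Tb : ℝ}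
    (hle : ∀ (S : ℝ) (u : ℝ → L2C), IsMildSolutionFor eulerForm a (Ico 0 S) u → S ≤ Tb) :
    ∃ Sm : ℝ, 0 < Sm ∧ Sm ≤ Tb ∧ ∃ U : ℝ → L2C, IsMildSolutionFor eulerForm a (Ico 0 Sm) U ∧
      (¬ ∃ S' : ℝ, Sm < S' ∧ ∃ v : ℝ → L2C,
        IsMildSolutionFor eulerForm a (Ico 0 S') v ∧ ∀ t ∈ Ico 0 Sm, v t = U t) ∧
      ∀ C : ℝ, ∃ t ∈ Ico 0 Sm, ENNReal.ofReal C < eFourierSobolevNorm 10 (U t) := by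
  obtain ⟨Sm, hSm, hSmTb, U, hU, hmax⟩ := exists_maximal_of_lifespan_le hth ha hle
  refine ⟨Sm, hSm, hSmTb, U, hU, hmax, fun C => ?_⟩
  by_contra hC
  push Not at hC
  exact hmax (hth.continuation a Sm hSm U hU C hC)

/-- **THEOREM B, part 3 (X5a from a lifespan bound).** For a Schwartz divergence-free datum whose
mild solutions all have lifespan `≤ Tb`, the true Navier–Stokes equations (`ν = 1`) have a classical,
finite-energy (Leray–Hopf) solution from a rapidly decaying datum with FINITE maximal time of smooth
existence — the statement `X5a` of the summit's negation side, conditional on the two named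
facts above. [cite: Tao2016AveragedNS, §1.1 (1.5)] -/
theorem x5a_of_lifespan_le (hth : H10MildTheory) (hblow : MildMaximalGivesBlowup)
    (u₀ : 𝓢(EuclideanSpace ℝ (Fin 3), EuclideanSpace ℝ (Fin 3)))
    (hdiv : VectorCalculus.IsDivFree ⇑u₀) (h10 : MemH10df (schwartzL2 u₀)) {Tb : ℝ}
    (hle : ∀ (S : ℝ) (u : ℝ → L2C), IsMildSolutionFor eulerForm (schwartzL2 u₀) (Ico 0 S) u → S ≤ Tb) :
    ∃ ν : ℝ, 0 < ν ∧ ∃ T : ℝ, 0 < T ∧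
      ∃ (u : ℝ → EuclideanSpace ℝ (Fin 3) → EuclideanSpace ℝ (Fin 3))
        (p : ℝ → EuclideanSpace ℝ (Fin 3) → ℝ),
        IsMaximalSmoothSolution ν 0 u p T ∧ IsLerayHopfOn T ν 0 (u 0) u ∧ HasRapidSpatialDecay (u 0) := by
  obtain ⟨Sm, hSm, -, U, hU, hmax⟩ := exists_maximal_of_lifespan_le hth h10 hle
  obtain ⟨T, hT, w, p, hw⟩ := hblow u₀ hdiv Sm hSm U hU hmax
  exact ⟨1, one_pos, T, hT, w, p, hw⟩

/-- **THE SOFT ASSEMBLY (A + B): a cascade witness for the true Navier–Stokes equations yields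
finite-time classical blow-up (X5a)**, conditional on the standard `H¹⁰_df` theory (two named
facts, all clauses proved in the tree on the summit side, where this becomes `¬ NavierStokesRegularity` via
the landed `blowup_assembly` + `blowup_clay_uniqueness`). HONEST FRAMING: nothing asserts that a
`CascadeWitness` exists; Tao's Thm. 1.5 provides one for an AVERAGED bilinear form, not for
`eulerForm`. [cite: Tao2016AveragedNS, §1.3 pp. 10–11] -/
theorem x5a_of_cascadeWitness (hth : H10MildTheory) (hblow : MildMaximalGivesBlowup)
    (W : CascadeWitness) :
    ∃ ν : ℝ, 0 < ν ∧ ∃ T : ℝ, 0 < T ∧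
      ∃ (u : ℝ → EuclideanSpace ℝ (Fin 3) → EuclideanSpace ℝ (Fin 3))
        (p : ℝ → EuclideanSpace ℝ (Fin 3) → ℝ),
        IsMaximalSmoothSolution ν 0 u p T ∧ IsLerayHopfOn T ν 0 (u 0) u ∧ HasRapidSpatialDecay (u 0) :=
  x5a_of_lifespan_le hth hblow W.u₀ W.divFree W.memH10df fun _ _ hu => W.lifespan_le hu

/-- **Norm blow-up from a cascade witness**: with the continuation criterion as well, the witness's
datum has a maximal mild Navier–Stokes solution on some `[0, S_m)`, `S_m ≤ T_* = ∑ T_n`, whose `H¹⁰`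
norm is unbounded. [cite: Tao2016AveragedNS, §1.3 pp. 10–11] -/
theorem normBlowup_of_cascadeWitness (hth : H10MildTheory) (W : CascadeWitness) :
    ∃ Sm : ℝ, 0 < Sm ∧ Sm ≤ W.Tstar ∧ ∃ U : ℝ → L2C,
      IsMildSolutionFor eulerForm (schwartzL2 W.u₀) (Ico 0 Sm) U ∧
      ∀ C : ℝ, ∃ t ∈ Ico 0 Sm, ENNReal.ofReal C < eFourierSobolevNorm 10 (U t) := by
  obtain ⟨Sm, hSm, hle, U, hU, -, hunb⟩ :=
    exists_maximal_unbounded_of_lifespan_le hth W.memH10df fun _ _ hu => W.lifespan_le hu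
  exact ⟨Sm, hSm, hle, U, hU, hunb⟩

end Literature.Analysis.FluidPDE.FluidComputer

end
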